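import Literature.NumberTheory.Rogawski1990.SingularObstruction
import HarnessLib

/-!
# The singular obstruction does not depend on the ORDER of the two eigenvalues: `obs_s^{(a,b)} = obs_s^{(b,a)}`
# (Rogawski 1990, §3.8 Prop. 3.8.1 (d) p. 37 — the `U(2)`-block and the `U(1)`-block carry the same norm class)

Topic `NumberTheory/Rogawski1990`; namespace `Literature.NumberTheory.Rogawski1990`; **THEOREMS ONLY** (no definition, no named fact, no instance,
no notation, no `sorry`).  Cell `pub/hodgecm-mathlib`, ENGINE T1 (crux H413 = `stmt-HodgeConjecture-24833`), O7 singular classes: the ADAPTER asked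
for by F0P5a-p03's TRUNK WORDS #8 (F1).  ★ `SingularSemisimpleFrame.exists_singular_frame` returns the eigenvalues in either order, while ★
`MatchingAdeleG₂.singularObs hab hγ₀` projects on the `a`-eigenspace of the caller's `(a, b)`; this file shows the choice is immaterial:
the complementary Lagrange idempotent is `e_{b,a} = 1 − e_{a,b}`, the two block determinants multiply to `det x_g = σ𝔸(det g) · det g` (★
`det_adelicCartan`), a NORM, and «global × norm» (★ `IsPrincipalAdelicNorm`) is stable under `δ ↦ N(c) · δ⁻¹`.

* §1 (generic) `blockDet_mul_blockDet_one_sub` — `blockDet e X · blockDet (1 − e) X = det X` for `e² = e` and `X ∈ Z(e)`;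
  `IsPrincipalAdelicNorm.of_mul_eq_adeleConj_mul` — `δ δ′ = σ𝔸(c) c` with `δ` «global × norm» ⇒ `δ′` «global × norm».
* §2 `adelicLagrangeIdem_swap` (`e_{b,a} = 1 − e_{a,b}`), `adelicBlockDet_swap_mul` (`blockDet_{b,a} · blockDet_{a,b} = σ𝔸(det g) det g`),
  **`MatchingAdeleG₂.singularObs_swap`**: `p.singularObs hab hγ₀ = p.singularObs hab.symm hγ₀′` (and `mul_sub_swap_eq_zero` producing `hγ₀′`).

## References
* [Rogawski1990] J. D. Rogawski, *Automorphic Representations of Unitary Groups in Three Variables*, Ann. of Math. Stud. 123 (1990), §3.8 Prop. 3.8.1 (d) p. 37.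
* [Kottwitz1986] R. E. Kottwitz, *Stable trace formula: elliptic singular terms*, Math. Ann. 275 (1986), §9.
-/

set_option autoImplicit false

noncomputable section

open NumberField IsDedekindDomain
open scoped Matrix MatrixGroups

namespace Literature.NumberTheory.Rogawski1990

open Literature.NumberTheory.Automorphic Literature.LinearAlgebra.Matrix
open Literature.AlgebraicGeometry.ShimuraVarieties (unitaryGroup mem_unitaryGroup_iff)

/-! ## §1 Generic: complementary blocks multiply to the determinant; «global × norm» under `δ ↦ N(c) δ⁻¹` -/

section Generic

variable {R : Type*} [CommRing R] {n : Type*} [Fintype n] [DecidableEq n]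

/-- **`blockDet e X · blockDet (1 − e) X = det X`** for an idempotent `e` and `X` commuting with `e`: the truncations are `e X + (1 − e)` and
`(1 − e) X + e`, whose product is `X`. [cite: Rogawski1990, §3.8 Prop. 3.8.1 p. 37] -/
theorem blockDet_mul_blockDet_one_sub {e X : Matrix n n R} (he : e * e = e) (hX : Commute X e) :
    blockDet e X * blockDet (1 - e) X = X.det := by
  have hf : (1 - e) * (1 - e) = (1 : Matrix n n R) - e := by
    rw [Matrix.sub_mul, Matrix.mul_sub, Matrix.mul_sub, Matrix.one_mul, Matrix.one_mul, Matrix.mul_one, he, sub_self, sub_zero]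
  have hef : e * (1 - e) = 0 := by rw [Matrix.mul_sub, Matrix.mul_one, he, sub_self]
  have hfe : (1 - e) * e = 0 := by rw [Matrix.sub_mul, Matrix.one_mul, he, sub_self]
  have h1 : e * X * e = e * X := by rw [Matrix.mul_assoc, hX.eq, ← Matrix.mul_assoc, he]
  have h2 : (1 - e) * X * (1 - e) = (1 - e) * X := by
    have hXf : X * (1 - e) = (1 - e) * X := by rw [Matrix.mul_sub, Matrix.sub_mul, Matrix.mul_one, Matrix.one_mul, hX.eq]
    rw [Matrix.mul_assoc, hXf, ← Matrix.mul_assoc, hf]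
  have hXf : X * (1 - e) = (1 - e) * X := by rw [Matrix.mul_sub, Matrix.sub_mul, Matrix.mul_one, Matrix.one_mul, hX.eq]
  have t1 : e * X * ((1 - e) * X) = 0 := by
    rw [Matrix.mul_assoc, ← Matrix.mul_assoc X, hXf, Matrix.mul_assoc, ← Matrix.mul_assoc, hef, Matrix.zero_mul]
  have t3 : (1 - e) * ((1 - e) * X) = (1 - e) * X := by rw [← Matrix.mul_assoc, hf]
  rw [blockDet_def, blockDet_def, ← Matrix.det_mul, h1, h2, sub_sub_cancel, Matrix.add_mul, Matrix.mul_add, Matrix.mul_add, t1, h1, t3, hfe,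
    zero_add, add_zero, ← Matrix.add_mul, add_sub_cancel, Matrix.one_mul]

variable {L : Type} [Field L] [NumberField L] [IsCMField L]

/-- **«Global × norm» passes from `δ` to `δ′` when `δ δ′` is a NORM**: `δ δ′ = σ𝔸(c) c` (`c`, `δ` adelic units) and `δ = (k ⊗ 1) σ𝔸(z) z` ⇒
`δ′ = (k⁻¹ ⊗ 1) · σ𝔸(c z⁻¹) (c z⁻¹)`. [cite: Rogawski1990, §3.8 Prop. 3.8.1 (d) p. 37] -/
theorem IsPrincipalAdelicNorm.of_mul_eq_adeleConj_mul {δ δ' c : AdeleRing (𝓞 L) L} (h : IsPrincipalAdelicNorm L δ) (hδ : IsUnit δ)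
    (hc : IsUnit c) (hprod : δ * δ' = adeleConj L c * c) : IsPrincipalAdelicNorm L δ' := by
  obtain ⟨k, z, hk0, hkc, hδeq⟩ := h
  refine ⟨k⁻¹, hc.unit * z⁻¹, inv_ne_zero hk0, by rw [map_inv₀, hkc], ?_⟩
  -- `δ′ = δ⁻¹ · σ(c) c`, with `δ⁻¹ = (k⁻¹ ⊗ 1) · σ(z⁻¹) z⁻¹`
  have hδ' : δ' = ((hδ.unit⁻¹ : (AdeleRing (𝓞 L) L)ˣ) : AdeleRing (𝓞 L) L) * (adeleConj L c * c) := by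
    rw [← hprod, ← mul_assoc, IsUnit.val_inv_mul, one_mul]
  have hδinv : ((hδ.unit⁻¹ : (AdeleRing (𝓞 L) L)ˣ) : AdeleRing (𝓞 L) L) =
      algebraMap L (AdeleRing (𝓞 L) L) k⁻¹ *
        (adeleConj L ((z⁻¹ : (AdeleRing (𝓞 L) L)ˣ) : AdeleRing (𝓞 L) L) * ((z⁻¹ : (AdeleRing (𝓞 L) L)ˣ) : AdeleRing (𝓞 L) L)) := by
    apply Units.inv_eq_of_mul_eq_one_right
    rw [IsUnit.unit_spec, hδeq]
    calc algebraMap L (AdeleRing (𝓞 L) L) k * (adeleConj L (z : AdeleRing (𝓞 L) L) * (z : AdeleRing (𝓞 L) L)) *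
          (algebraMap L (AdeleRing (𝓞 L) L) k⁻¹ *
            (adeleConj L ((z⁻¹ : (AdeleRing (𝓞 L) L)ˣ) : AdeleRing (𝓞 L) L) * ((z⁻¹ : (AdeleRing (𝓞 L) L)ˣ) : AdeleRing (𝓞 L) L)))
          = (algebraMap L (AdeleRing (𝓞 L) L) k * algebraMap L (AdeleRing (𝓞 L) L) k⁻¹) *
              (adeleConj L (z : AdeleRing (𝓞 L) L) * adeleConj L ((z⁻¹ : (AdeleRing (𝓞 L) L)ˣ) : AdeleRing (𝓞 L) L)) *
              ((z : AdeleRing (𝓞 L) L) * ((z⁻¹ : (AdeleRing (𝓞 L) L)ˣ) : AdeleRing (𝓞 L) L)) := by ring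
      _ = 1 := by rw [← map_mul, ← map_mul, mul_inv_cancel₀ hk0, Units.mul_inv, map_one, map_one, one_mul, one_mul]
  rw [hδ', hδinv, Units.val_mul, IsUnit.unit_spec, map_mul]
  ring

end Generic

/-! ## §2 The swap `(a, b) ↔ (b, a)` -/

section Swap

variable {L : Type} [Field L] [NumberField L] [IsCMField L] {H : Matrix (Fin 3) (Fin 3) L}
  {γ₀ : (UnitaryGroup.cmDatum L 3 H).Rational} {a b : L}

/-- The quadratic relation with the factors swapped. [cite: Rogawski1990, §3.8 p. 37] -/
theorem mul_sub_swap_eq_zero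
    (hγ₀ : ((((γ₀ : unitaryGroup (cmConjRingHom L) H).val : GL (Fin 3) L) : Matrix (Fin 3) (Fin 3) L) - a • (1 : Matrix (Fin 3) (Fin 3) L)) *
      ((((γ₀ : unitaryGroup (cmConjRingHom L) H).val : GL (Fin 3) L) : Matrix (Fin 3) (Fin 3) L) - b • (1 : Matrix (Fin 3) (Fin 3) L)) = 0) :
    ((((γ₀ : unitaryGroup (cmConjRingHom L) H).val : GL (Fin 3) L) : Matrix (Fin 3) (Fin 3) L) - b • (1 : Matrix (Fin 3) (Fin 3) L)) *
      ((((γ₀ : unitaryGroup (cmConjRingHom L) H).val : GL (Fin 3) L) : Matrix (Fin 3) (Fin 3) L) - a • (1 : Matrix (Fin 3) (Fin 3) L)) = 0 := by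
  have hc : Commute ((((γ₀ : unitaryGroup (cmConjRingHom L) H).val : GL (Fin 3) L) : Matrix (Fin 3) (Fin 3) L) - b • (1 : Matrix (Fin 3) (Fin 3) L))
      ((((γ₀ : unitaryGroup (cmConjRingHom L) H).val : GL (Fin 3) L) : Matrix (Fin 3) (Fin 3) L) - a • (1 : Matrix (Fin 3) (Fin 3) L)) :=
    ((Commute.refl _).sub_right ((Commute.one_right _).smul_right a)).sub_left ((Commute.one_left _).smul_left b)
  rw [hc.eq, hγ₀]

/-- **`e_{b,a} ⊗ 1 = 1 − e_{a,b} ⊗ 1`**: the Lagrange idempotents of the two eigenvalues are complementary. [cite: Rogawski1990, §3.8 p. 37] -/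
theorem adelicLagrangeIdem_swap (hab : a ≠ b) : adelicLagrangeIdem γ₀ b a = 1 - adelicLagrangeIdem γ₀ a b := by
  rw [adelicLagrangeIdem_eq, adelicLagrangeIdem_eq]
  set alg := algebraMap L (AdeleRing (𝓞 L) L) with halg
  set γA : Matrix (Fin 3) (Fin 3) (AdeleRing (𝓞 L) L) :=
    ((((UnitaryGroup.cmDatum L 3 H).toAdelic γ₀).val : GL (Fin 3) (AdeleRing (𝓞 L) L)) : Matrix (Fin 3) (Fin 3) (AdeleRing (𝓞 L) L)) with hγA
  have hba : (b - a)⁻¹ = -(a - b)⁻¹ := by rw [← neg_sub, neg_inv]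
  have hsum : alg (a - b)⁻¹ • (γA - alg b • (1 : Matrix (Fin 3) (Fin 3) (AdeleRing (𝓞 L) L))) +
      alg (b - a)⁻¹ • (γA - alg a • (1 : Matrix (Fin 3) (Fin 3) (AdeleRing (𝓞 L) L))) = 1 := by
    rw [hba, map_neg, neg_smul, ← sub_eq_add_neg, ← smul_sub, sub_sub_sub_cancel_left, ← sub_smul, smul_smul, ← map_sub, ← map_mul,
      inv_mul_cancel₀ (sub_ne_zero.2 hab), map_one, one_smul]
  rw [eq_sub_iff_add_eq, add_comm, hsum]

/-- **`blockDet_{b,a}(x_g) · blockDet_{a,b}(x_g) = det x_g = σ𝔸(det g) · det g`** — the two block determinants multiply to a NORM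
(`blockDet_mul_blockDet_one_sub`, ★ `det_adelicCartan`). [cite: Rogawski1990, §3.8 Prop. 3.8.1 (d) p. 37] [cite: Kottwitz1986, §9] -/
theorem adelicBlockDet_mul_adelicBlockDet_swap (hHd : IsUnit H.det) (hab : a ≠ b)
    (hγ₀ : ((((γ₀ : unitaryGroup (cmConjRingHom L) H).val : GL (Fin 3) L) : Matrix (Fin 3) (Fin 3) L) - a • (1 : Matrix (Fin 3) (Fin 3) L)) *
      ((((γ₀ : unitaryGroup (cmConjRingHom L) H).val : GL (Fin 3) L) : Matrix (Fin 3) (Fin 3) L) - b • (1 : Matrix (Fin 3) (Fin 3) L)) = 0)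
    (p : MatchingAdeleG₂ L H H γ₀) {g : GL (Fin 3) (AdeleRing (𝓞 L) L)}
    (hg : g * (((UnitaryGroup.cmDatum L 3 H).toAdelic γ₀).val : GL (Fin 3) (AdeleRing (𝓞 L) L)) * g⁻¹ = (p.adele.val : GL (Fin 3) (AdeleRing (𝓞 L) L))) :
    adelicBlockDet γ₀ a b g * adelicBlockDet γ₀ b a g =
      adeleConj L (g : Matrix (Fin 3) (Fin 3) (AdeleRing (𝓞 L) L)).det * (g : Matrix (Fin 3) (Fin 3) (AdeleRing (𝓞 L) L)).det := by
  rw [adelicBlockDet_def, adelicBlockDet_def, adelicLagrangeIdem_swap hab,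
    blockDet_mul_blockDet_one_sub (adelicLagrangeIdem_mul_self hab hγ₀) (commute_adelicLagrangeIdem (commute_adelicCartan hHd p hg)),
    det_adelicCartan hHd]

/-- **`obs_s` IS SYMMETRIC IN `(a, b)`**: `p.singularObs hab hγ₀ = p.singularObs hab.symm hγ₀′` — projecting on the `a`-eigenspace or on the
`b`-eigenspace gives the same obstruction, because the two block determinants multiply to the norm `σ𝔸(det g) det g` and «global × norm» is stable
under `δ ↦ N(c) δ⁻¹` (`IsPrincipalAdelicNorm.of_mul_eq_adeleConj_mul`).  So a consumer may read `singularObs` in EITHER frame ordering of ★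
`exists_singular_frame`. [cite: Rogawski1990, §3.8 Prop. 3.8.1 (d) p. 37] [cite: Kottwitz1986, §9] -/
theorem MatchingAdeleG₂.singularObs_swap (hHd : IsUnit H.det) (hab : a ≠ b) (ha : a * cmConjRingHom L a = 1) (hb : b * cmConjRingHom L b = 1)
    (hγ₀ : ((((γ₀ : unitaryGroup (cmConjRingHom L) H).val : GL (Fin 3) L) : Matrix (Fin 3) (Fin 3) L) - a • (1 : Matrix (Fin 3) (Fin 3) L)) *
      ((((γ₀ : unitaryGroup (cmConjRingHom L) H).val : GL (Fin 3) L) : Matrix (Fin 3) (Fin 3) L) - b • (1 : Matrix (Fin 3) (Fin 3) L)) = 0)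
    (hγ₀' : ((((γ₀ : unitaryGroup (cmConjRingHom L) H).val : GL (Fin 3) L) : Matrix (Fin 3) (Fin 3) L) - b • (1 : Matrix (Fin 3) (Fin 3) L)) *
      ((((γ₀ : unitaryGroup (cmConjRingHom L) H).val : GL (Fin 3) L) : Matrix (Fin 3) (Fin 3) L) - a • (1 : Matrix (Fin 3) (Fin 3) L)) = 0)
    (p : MatchingAdeleG₂ L H H γ₀) : p.singularObs hab hγ₀ = p.singularObs hab.symm hγ₀' := by
  obtain ⟨g, hg⟩ := MatchingAdeleG₂.exists_gl_conj_eq_adele_of_mul_sub_eq_zero hab hγ₀ p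
  have hprod := adelicBlockDet_mul_adelicBlockDet_swap hHd hab hγ₀ p hg
  have hprod' : adelicBlockDet γ₀ b a g * adelicBlockDet γ₀ a b g =
      adeleConj L (g : Matrix (Fin 3) (Fin 3) (AdeleRing (𝓞 L) L)).det * (g : Matrix (Fin 3) (Fin 3) (AdeleRing (𝓞 L) L)).det := by
    rw [mul_comm, hprod]
  have hδ : IsUnit (adelicBlockDet γ₀ a b g) := isUnit_adelicBlockDet hHd hab hγ₀ p hg
  have hδ' : IsUnit (adelicBlockDet γ₀ b a g) := isUnit_adelicBlockDet hHd hab.symm hγ₀' p hg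
  have hc : IsUnit (g : Matrix (Fin 3) (Fin 3) (AdeleRing (𝓞 L) L)).det := Matrix.isUnits_det_units g
  have hiff : p.singularObs hab hγ₀ = 0 ↔ p.singularObs hab.symm hγ₀' = 0 := by
    rw [p.singularObs_eq_zero_iff hHd hab ha hb hγ₀ hg, p.singularObs_eq_zero_iff hHd hab.symm hb ha hγ₀' hg]
    exact ⟨fun h => h.of_mul_eq_adeleConj_mul hδ hc hprod, fun h => h.of_mul_eq_adeleConj_mul hδ' hc hprod'⟩
  rcases p.singularObs_eq_zero_or_eq_one hab hγ₀ with h0 | h1 <;>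
    rcases p.singularObs_eq_zero_or_eq_one hab.symm hγ₀' with h0' | h1'
  · rw [h0, h0']
  · exact absurd (hiff.1 h0) (by rw [h1']; exact one_ne_zero)
  · exact absurd (hiff.2 h0') (by rw [h1]; exact one_ne_zero)
  · rw [h1, h1']

end Swap

end Literature.NumberTheory.Rogawski1990

end
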